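import Summits.SmoothPoincare4.Statement
import Literature.Topology.FourManifolds.GluckTwist
import Literature.Topology.FourManifolds.GluckTwistUnknotProofs
import Literature.Topology.FourManifolds.HomotopyBallSliceSphereProofs
import Literature.Topology.FourManifolds.Rasmussen
import Literature.Topology.FourManifolds.DehnSurgeryProofs
import Literature.Barriers.SmoothPoincare4.GluckTwistsDissolve
import Literature.Uncategorized.Crux
import Summits.SmoothPoincare4.SmoothPoincare4.Theorems.ZseSVanishesOnPairs.Negative.Position
import Summits.SmoothPoincare4.SmoothPoincare4.Theorems.ZseSVanishesOnPairs.Negative.LoadBearing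

/-!
# Where the Gluck lever of line `two-knot-meridional-dual` sits (negative lemmas for crux stmt-SmoothPoincare4-0368)

Crux `ZeroSurgeryExotic.ZseSVanishesOnPairs` (item `stmt-SmoothPoincare4-0368`) = the tree's open statement
`Literature.Uncategorized.SVanishesOnPairs`.  The lead's picked line `two-knot-meridional-dual` (skeleton of
2026-08-16T00:34Z, stubs recovered from the ledger stub archive) has exactly two stubs, both over tree
vocabulary only:

* stub A `stub_gluckSliceTransfer` — the LEVER: on every `0`-surgery pair `(K, K')` with `K` smoothly slice,
  `K'` bounds a smooth proper disc off a ball in some smooth Gluck twist `X` of `S⁴`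
  (`IsGluckTwist (𝓡 4) X K₂`, `K'.IsSliceDiscIn X e f`);
* stub B `stub_mmswGluckVanishing` — verbatim the Barriers named fact
  `Literature.Barriers.SmoothPoincare4.rasmussen_eq_zero_of_isSliceDiscIn_gluckTwist` (MMSW 2023, Cor. 1.13),
  see `mmswGluckVanishing_iff_fact`.

`Negative/Targets.lean` (standing disprover) proved: A ∧ B ⇒ crux, A ∧ (route thesis X) ⇒ an exotic Gluck
twist, A ∧ "Gluck twists standard" ⇒ the kill switch.  This file (deep-refute seat on the stub set) closes
the position of stub A from the other side and records its load-bearing analysis: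

* `sliceInSomeGluckTwist_of_isSmoothlySlice` — UNCONDITIONAL: a smoothly slice knot is slice in SOME Gluck
  twist, namely in `S⁴` itself, which IS the Gluck twist along the unknotted sphere (PROVED tree theorem
  `isGluckTwist_sphere_unknotTwo_holds`) — the slice disc is pushed off a round ball by the PROVED
  `Knot.IsSliceDisc.isSliceDiscIn_sphere`;
* `exists_pair_not_slice_of_not_gluckLever` / `not_spc4_of_not_gluckLever` / `gluckLever_of_spc4` —
  UNCONDITIONAL: a refutation of stub A is (at least) a witness of the route's thesis X (a `0`-surgery pair,
  `K` slice, `K'` not slice) and hence, through the PROVED Manolescu–Piccirillo Lemma 3.3 and FGMW lemma, a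
  disproof of `SmoothPoincare4`; dually `SmoothPoincare4` implies stub A.  So stub A cannot be refuted by
  any means short of an exotic `S⁴`, and cannot be proved short of the line's real content;
* `gluckLever_of_zeroSurgeryDeterminesSliceness` — the kill-switch body implies stub A;
* `gluckLever_false_without_slice_of_mmsw113` (and `…commonSurgery…`, `…surgeryLeft…`, `…surgeryRight…`) —
  every hypothesis of stub A is load-bearing, GIVEN stub B (the only Gluck-twist slice obstruction in the
  tree): witnesses the positive trefoil (`s = 2`, PROVED) and the unknot;
* `gluckLever_diagonal_unknot` — the hypotheses of stub A are jointly satisfiable together with its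
  conclusion (no vacuity).
No definitions; no route item is concluded positively (the thesis is spelled out as an anonymous `∃`).
-/

noncomputable section

set_option linter.dupNamespace false

open scoped Manifold ContDiff
open Literature.Topology.FourManifolds Literature.Uncategorized

namespace Summit.SmoothPoincare4.SmoothPoincare4.Theorems.ZseSVanishesOnPairs.Negative

/-- **Stub B of the line is the Barriers named fact, verbatim**: the registered signature of
`stub_mmswGluckVanishing` and `rasmussen_eq_zero_of_isSliceDiscIn_gluckTwist` (MMSW 2023 Cor. 1.13, knot
case; NOT discharged in the tree, and it implies Rasmussen's Theorem 1,
`rasmussen_eq_zero_of_isSliceDiscIn_gluckTwist.eq_zero_of_isSmoothlySlice`) are the same proposition.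
[cite: ManolescuMarengonSarkarWillis2023, Cor. 1.13] -/
theorem mmswGluckVanishing_iff_fact :
    (∀ (K₂ : TwoKnot) (X : Type) [TopologicalSpace X] [T2Space X] [SecondCountableTopology X]
        [ChartedSpace (EuclideanSpace ℝ (Fin 4)) X] [IsManifold (𝓡 4) ∞ X] (_hX : IsGluckTwist (𝓡 4) X K₂)
        (K : Knot) (e : EuclideanSpace ℝ (Fin 4) → X) (f : EuclideanSpace ℝ (Fin 2) → X)
        (_hK : K.IsSliceDiscIn X e f) (s : ℤ) (_hs : K.HasRasmussenInvariant s), s = 0) ↔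
      Literature.Barriers.SmoothPoincare4.rasmussen_eq_zero_of_isSliceDiscIn_gluckTwist :=
  Iff.rfl

/-- **Every smoothly slice knot is slice in some Gluck twist of `S⁴`** — in `S⁴` itself, the Gluck
twist along the unknotted 2-sphere (`isGluckTwist_sphere_unknotTwo_holds`, Gluck 1962 §17, PROVED in the
tree), the slice disc being pushed off the round ball of a stereographic chart
(`Knot.IsSliceDisc.isSliceDiscIn_sphere`, PROVED).  Unconditional; this is the diagonal `K' = K` of stub A.
[cite: GluckTAMS1962, §17] -/
theorem sliceInSomeGluckTwist_of_isSmoothlySlice {K : Knot} (hK : K.IsSmoothlySlice) :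
    ∃ (K₂ : TwoKnot) (X : Type) (_ : TopologicalSpace X) (_ : T2Space X)
      (_ : SecondCountableTopology X) (_ : ChartedSpace (EuclideanSpace ℝ (Fin 4)) X)
      (_ : IsManifold (𝓡 4) ∞ X), IsGluckTwist (𝓡 4) X K₂ ∧
        ∃ (e : EuclideanSpace ℝ (Fin 4) → X) (f : EuclideanSpace ℝ (Fin 2) → X), K.IsSliceDiscIn X e f := by
  obtain ⟨g, hg⟩ := hK
  let a : Metric.sphere (0 : EuclideanSpace ℝ (Fin 5)) 1 := ⟨EuclideanSpace.single 0 1, by simp⟩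
  exact ⟨unknotTwo, Metric.sphere (0 : EuclideanSpace ℝ (Fin 5)) 1, _, inferInstance, inferInstance, _,
    inferInstance, isGluckTwist_sphere_unknotTwo_holds, _, _, hg.isSliceDiscIn_sphere a⟩

/-- **A refutation of stub A is a witness of the route's thesis.** If the LEVER fails, some `0`-surgery
pair `(K, K')` has `K` smoothly slice and `K'` NOT smoothly slice (else `K'` would be slice in the Gluck
twist `S⁴`, `sliceInSomeGluckTwist_of_isSmoothlySlice`).  Unconditional.  (The `∃` is the body of route
item `ZseThesis`, stmt-SmoothPoincare4-0364, spelled out.) [folklore] -/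
theorem exists_pair_not_slice_of_not_gluckLever
    (h : ¬ ∀ (K K' : Knot) (Y : Type) [TopologicalSpace Y] [ChartedSpace (EuclideanSpace ℝ (Fin 3)) Y],
      IsIntegralSurgery (𝓡 3) Y K 0 → IsIntegralSurgery (𝓡 3) Y K' 0 → K.IsSmoothlySlice →
      ∃ (K₂ : TwoKnot) (X : Type) (_ : TopologicalSpace X) (_ : T2Space X)
        (_ : SecondCountableTopology X) (_ : ChartedSpace (EuclideanSpace ℝ (Fin 4)) X)
        (_ : IsManifold (𝓡 4) ∞ X), IsGluckTwist (𝓡 4) X K₂ ∧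
          ∃ (e : EuclideanSpace ℝ (Fin 4) → X) (f : EuclideanSpace ℝ (Fin 2) → X), K'.IsSliceDiscIn X e f) :
    ∃ (K K' : Knot) (Y : Type) (_ : TopologicalSpace Y) (_ : ChartedSpace (EuclideanSpace ℝ (Fin 3)) Y),
      IsIntegralSurgery (𝓡 3) Y K 0 ∧ IsIntegralSurgery (𝓡 3) Y K' 0 ∧ K.IsSmoothlySlice ∧
        ¬ K'.IsSmoothlySlice := by
  by_contra hX
  refine h fun K K' Y _ _ h1 h2 h3 ↦ sliceInSomeGluckTwist_of_isSmoothlySlice ?_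
  by_contra h4
  exact hX ⟨K, K', Y, _, _, h1, h2, h3, h4⟩

/-- **A refutation of stub A disproves `SmoothPoincare4`.**  The witnessing `K'` is slice in a homotopy
4-ball (Manolescu–Piccirillo Lemma 3.3, PROVED: `isHomotopyBallSlice_of_zeroSurgeryPair`) and not slice,
which `SmoothPoincare4` forbids (`isSmoothlySlice_of_isHomotopyBallSlice_of_spc4`, the PROVED FGMW lemma).
Unconditional: stub A is irrefutable by anything short of an exotic 4-sphere.
[cite: ManolescuPiccirillo2023, Lemma 3.3] [cite: FreedmanGompfMorrisonWalker2010, §1] -/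
theorem not_spc4_of_not_gluckLever
    (h : ¬ ∀ (K K' : Knot) (Y : Type) [TopologicalSpace Y] [ChartedSpace (EuclideanSpace ℝ (Fin 3)) Y],
      IsIntegralSurgery (𝓡 3) Y K 0 → IsIntegralSurgery (𝓡 3) Y K' 0 → K.IsSmoothlySlice →
      ∃ (K₂ : TwoKnot) (X : Type) (_ : TopologicalSpace X) (_ : T2Space X)
        (_ : SecondCountableTopology X) (_ : ChartedSpace (EuclideanSpace ℝ (Fin 4)) X)
        (_ : IsManifold (𝓡 4) ∞ X), IsGluckTwist (𝓡 4) X K₂ ∧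
          ∃ (e : EuclideanSpace ℝ (Fin 4) → X) (f : EuclideanSpace ℝ (Fin 2) → X), K'.IsSliceDiscIn X e f) :
    ¬ _root_.SmoothPoincare4 := by
  intro hS
  obtain ⟨K, K', Y, _, _, h1, h2, h3, h4⟩ := exists_pair_not_slice_of_not_gluckLever h
  exact h4 (isSmoothlySlice_of_isHomotopyBallSlice_of_spc4 hS
    (isHomotopyBallSlice_of_zeroSurgeryPair h1 h2 h3))

/-- **`SmoothPoincare4` implies stub A** (contrapositive of `not_spc4_of_not_gluckLever`): under SPC4
the partner `K'` is slice, hence slice in the Gluck twist `S⁴`.  So the stub is sandwiched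
`SPC4 ⇒ A ⇒ (with MMSW Cor. 1.13) crux`, exactly like the crux itself (`sVanishesOnPairs_of_spc4`).
Unconditional. [cite: ManolescuPiccirillo2023, Lemma 3.3] -/
theorem gluckLever_of_spc4 (hS : _root_.SmoothPoincare4) :
    ∀ (K K' : Knot) (Y : Type) [TopologicalSpace Y] [ChartedSpace (EuclideanSpace ℝ (Fin 3)) Y],
      IsIntegralSurgery (𝓡 3) Y K 0 → IsIntegralSurgery (𝓡 3) Y K' 0 → K.IsSmoothlySlice →
      ∃ (K₂ : TwoKnot) (X : Type) (_ : TopologicalSpace X) (_ : T2Space X)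
        (_ : SecondCountableTopology X) (_ : ChartedSpace (EuclideanSpace ℝ (Fin 4)) X)
        (_ : IsManifold (𝓡 4) ∞ X), IsGluckTwist (𝓡 4) X K₂ ∧
          ∃ (e : EuclideanSpace ℝ (Fin 4) → X) (f : EuclideanSpace ℝ (Fin 2) → X), K'.IsSliceDiscIn X e f := by
  by_contra h
  exact not_spc4_of_not_gluckLever h hS

/-- **The kill switch implies stub A**: if the `0`-surgery type determines smooth sliceness (body of
route item `Assembly2`, stmt-SmoothPoincare4-0367), then every partner `K'` is slice, hence slice in the
Gluck twist `S⁴`.  Unconditional. [folklore] -/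
theorem gluckLever_of_zeroSurgeryDeterminesSliceness
    (hA : ∀ (K K' : Knot) (Y : Type) [TopologicalSpace Y] [ChartedSpace (EuclideanSpace ℝ (Fin 3)) Y],
      IsIntegralSurgery (𝓡 3) Y K 0 → IsIntegralSurgery (𝓡 3) Y K' 0 → K.IsSmoothlySlice →
      K'.IsSmoothlySlice) :
    ∀ (K K' : Knot) (Y : Type) [TopologicalSpace Y] [ChartedSpace (EuclideanSpace ℝ (Fin 3)) Y],
      IsIntegralSurgery (𝓡 3) Y K 0 → IsIntegralSurgery (𝓡 3) Y K' 0 → K.IsSmoothlySlice →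
      ∃ (K₂ : TwoKnot) (X : Type) (_ : TopologicalSpace X) (_ : T2Space X)
        (_ : SecondCountableTopology X) (_ : ChartedSpace (EuclideanSpace ℝ (Fin 4)) X)
        (_ : IsManifold (𝓡 4) ∞ X), IsGluckTwist (𝓡 4) X K₂ ∧
          ∃ (e : EuclideanSpace ℝ (Fin 4) → X) (f : EuclideanSpace ℝ (Fin 2) → X), K'.IsSliceDiscIn X e f :=
  fun K K' Y _ _ h1 h2 h3 ↦ sliceInSomeGluckTwist_of_isSmoothlySlice (hA K K' Y h1 h2 h3)

/-- **The positive trefoil is slice in NO Gluck twist of `S⁴`, GIVEN MMSW Cor. 1.13** (stub B / the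
Barriers fact): its Rasmussen invariant is `2` (`hasRasmussenInvariant_trefoil_two`, PROVED).  This is the
only Gluck-twist slice obstruction available in the tree, whence the conditional form.
[cite: ManolescuMarengonSarkarWillis2023, Cor. 1.13] [cite: Rasmussen2010, Thm. 4] -/
theorem trefoil_not_sliceInSomeGluckTwist_of_mmsw113
    (h113 : Literature.Barriers.SmoothPoincare4.rasmussen_eq_zero_of_isSliceDiscIn_gluckTwist) :
    ¬ ∃ (K₂ : TwoKnot) (X : Type) (_ : TopologicalSpace X) (_ : T2Space X)
        (_ : SecondCountableTopology X) (_ : ChartedSpace (EuclideanSpace ℝ (Fin 4)) X)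
        (_ : IsManifold (𝓡 4) ∞ X), IsGluckTwist (𝓡 4) X K₂ ∧
          ∃ (e : EuclideanSpace ℝ (Fin 4) → X) (f : EuclideanSpace ℝ (Fin 2) → X),
            (torusKnot 2 3 le_rfl (by norm_num) (by decide)).IsSliceDiscIn X e f := by
  rintro ⟨K₂, X, _, _, _, _, _, hX, e, f, hf⟩
  exact two_ne_zero (h113 K₂ X hX _ e f hf 2 hasRasmussenInvariant_trefoil_two)

/-- **`K.IsSmoothlySlice` is load-bearing in stub A** (given MMSW Cor. 1.13): without it the lever would
make `K = K' = T(2,3)`, `Y = S³₀(T(2,3))` (`exists_isIntegralSurgery_holds`) slice in a Gluck twist.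
[cite: ManolescuMarengonSarkarWillis2023, Cor. 1.13] -/
theorem gluckLever_false_without_slice_of_mmsw113
    (h113 : Literature.Barriers.SmoothPoincare4.rasmussen_eq_zero_of_isSliceDiscIn_gluckTwist) :
    ¬ ∀ (K K' : Knot) (Y : Type) [TopologicalSpace Y] [ChartedSpace (EuclideanSpace ℝ (Fin 3)) Y],
      IsIntegralSurgery (𝓡 3) Y K 0 → IsIntegralSurgery (𝓡 3) Y K' 0 →
      ∃ (K₂ : TwoKnot) (X : Type) (_ : TopologicalSpace X) (_ : T2Space X)
        (_ : SecondCountableTopology X) (_ : ChartedSpace (EuclideanSpace ℝ (Fin 4)) X)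
        (_ : IsManifold (𝓡 4) ∞ X), IsGluckTwist (𝓡 4) X K₂ ∧
          ∃ (e : EuclideanSpace ℝ (Fin 4) → X) (f : EuclideanSpace ℝ (Fin 2) → X), K'.IsSliceDiscIn X e f := by
  intro h
  obtain ⟨Y, _, _, _, _, _, _, hY⟩ :=
    exists_isIntegralSurgery_holds (torusKnot 2 3 le_rfl (by norm_num) (by decide)) 0
  exact trefoil_not_sliceInSomeGluckTwist_of_mmsw113 h113 (h _ _ Y hY hY)

/-- **The common `0`-surgery is load-bearing in stub A** (given MMSW Cor. 1.13): with no relation between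
`K` and `K'`, take `K =` unknot (slice, `isSmoothlySlice_unknot`) and `K' = T(2,3)`.
[cite: ManolescuMarengonSarkarWillis2023, Cor. 1.13] -/
theorem gluckLever_false_without_commonSurgery_of_mmsw113
    (h113 : Literature.Barriers.SmoothPoincare4.rasmussen_eq_zero_of_isSliceDiscIn_gluckTwist) :
    ¬ ∀ (K K' : Knot), K.IsSmoothlySlice →
      ∃ (K₂ : TwoKnot) (X : Type) (_ : TopologicalSpace X) (_ : T2Space X)
        (_ : SecondCountableTopology X) (_ : ChartedSpace (EuclideanSpace ℝ (Fin 4)) X)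
        (_ : IsManifold (𝓡 4) ∞ X), IsGluckTwist (𝓡 4) X K₂ ∧
          ∃ (e : EuclideanSpace ℝ (Fin 4) → X) (f : EuclideanSpace ℝ (Fin 2) → X), K'.IsSliceDiscIn X e f :=
  fun h ↦ trefoil_not_sliceInSomeGluckTwist_of_mmsw113 h113 (h unknot _ isSmoothlySlice_unknot)

/-- **`IsIntegralSurgery (𝓡 3) Y K' 0` is load-bearing in stub A** (given MMSW Cor. 1.13): `K =` unknot,
`Y = S³₀(unknot)`, `K' = T(2,3)` unrelated to `Y`. [cite: ManolescuMarengonSarkarWillis2023, Cor. 1.13] -/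
theorem gluckLever_false_without_surgeryRight_of_mmsw113
    (h113 : Literature.Barriers.SmoothPoincare4.rasmussen_eq_zero_of_isSliceDiscIn_gluckTwist) :
    ¬ ∀ (K K' : Knot) (Y : Type) [TopologicalSpace Y] [ChartedSpace (EuclideanSpace ℝ (Fin 3)) Y],
      IsIntegralSurgery (𝓡 3) Y K 0 → K.IsSmoothlySlice →
      ∃ (K₂ : TwoKnot) (X : Type) (_ : TopologicalSpace X) (_ : T2Space X)
        (_ : SecondCountableTopology X) (_ : ChartedSpace (EuclideanSpace ℝ (Fin 4)) X)
        (_ : IsManifold (𝓡 4) ∞ X), IsGluckTwist (𝓡 4) X K₂ ∧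
          ∃ (e : EuclideanSpace ℝ (Fin 4) → X) (f : EuclideanSpace ℝ (Fin 2) → X), K'.IsSliceDiscIn X e f := by
  intro h
  obtain ⟨Y, _, _, _, _, _, _, hY⟩ := exists_isIntegralSurgery_holds unknot 0
  exact trefoil_not_sliceInSomeGluckTwist_of_mmsw113 h113 (h unknot _ Y hY isSmoothlySlice_unknot)

/-- **`IsIntegralSurgery (𝓡 3) Y K 0` is load-bearing in stub A** (given MMSW Cor. 1.13): `K =` unknot
unrelated to `Y = S³₀(T(2,3))`, `K' = T(2,3)`. [cite: ManolescuMarengonSarkarWillis2023, Cor. 1.13] -/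
theorem gluckLever_false_without_surgeryLeft_of_mmsw113
    (h113 : Literature.Barriers.SmoothPoincare4.rasmussen_eq_zero_of_isSliceDiscIn_gluckTwist) :
    ¬ ∀ (K K' : Knot) (Y : Type) [TopologicalSpace Y] [ChartedSpace (EuclideanSpace ℝ (Fin 3)) Y],
      IsIntegralSurgery (𝓡 3) Y K' 0 → K.IsSmoothlySlice →
      ∃ (K₂ : TwoKnot) (X : Type) (_ : TopologicalSpace X) (_ : T2Space X)
        (_ : SecondCountableTopology X) (_ : ChartedSpace (EuclideanSpace ℝ (Fin 4)) X)
        (_ : IsManifold (𝓡 4) ∞ X), IsGluckTwist (𝓡 4) X K₂ ∧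
          ∃ (e : EuclideanSpace ℝ (Fin 4) → X) (f : EuclideanSpace ℝ (Fin 2) → X), K'.IsSliceDiscIn X e f := by
  intro h
  obtain ⟨Y, _, _, _, _, _, _, hY⟩ :=
    exists_isIntegralSurgery_holds (torusKnot 2 3 le_rfl (by norm_num) (by decide)) 0
  exact trefoil_not_sliceInSomeGluckTwist_of_mmsw113 h113 (h unknot _ Y hY isSmoothlySlice_unknot)

/-- **Stub A is not vacuous**: its three hypotheses and its conclusion hold together on the diagonal
`K = K' =` unknot, `Y = S³₀(unknot)`.  Unconditional. [folklore] -/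
theorem gluckLever_diagonal_unknot :
    ∃ (Y : Type) (_ : TopologicalSpace Y) (_ : ChartedSpace (EuclideanSpace ℝ (Fin 3)) Y),
      IsIntegralSurgery (𝓡 3) Y unknot 0 ∧ unknot.IsSmoothlySlice ∧
      ∃ (K₂ : TwoKnot) (X : Type) (_ : TopologicalSpace X) (_ : T2Space X)
        (_ : SecondCountableTopology X) (_ : ChartedSpace (EuclideanSpace ℝ (Fin 4)) X)
        (_ : IsManifold (𝓡 4) ∞ X), IsGluckTwist (𝓡 4) X K₂ ∧
          ∃ (e : EuclideanSpace ℝ (Fin 4) → X) (f : EuclideanSpace ℝ (Fin 2) → X),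
            unknot.IsSliceDiscIn X e f := by
  obtain ⟨Y, _, _, _, _, _, _, hY⟩ := exists_isIntegralSurgery_holds unknot 0
  exact ⟨Y, _, _, hY, isSmoothlySlice_unknot,
    sliceInSomeGluckTwist_of_isSmoothlySlice isSmoothlySlice_unknot⟩

end Summit.SmoothPoincare4.SmoothPoincare4.Theorems.ZseSVanishesOnPairs.Negative
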